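import Literature.Computability.MetaComplexity.ParityOfModConditions
import HarnessLib

/-!
# Cell qa-qnc0, plan S2 engine: characters of `𝔽₃`, signed three-term sums, and OFF-JUNTA DECAY (tools for BLOCK-Φ)

Support for crux `RingDenseResidualLt3` (stmt-QuantumAdvantage-22907), route `DWalkThree`; planner qa-qnc0-p1 g21
ROUND-20 §2.9′ (BLOCK-Φ).  Generic tools, no cell objects:
* `sum_stdAddChar_three` (orthogonality on `𝔽₃`, from `Literature.Analysis.Fourier.sum_stdAddChar_mul`),
  `stdAddChar_sum_eq_prod`, `norm_stdAddChar_three`, `zmod3_cases`;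
* `exists_odd_one_out`, `signedCharSum_three_degen`, `norm_signedCharSum_three` — a signed sum `Σ_{a ∈ 𝔽₃} (−1)^{n_a} ω^{s a}`
  equals `(−1)^{n_0}·3·[s = 0]` if the three parities agree and has norm EXACTLY `1` (`s = 0`) / `2` (`s ≠ 0`) otherwise
  (the two equal signs cancel against the dissenter through `1 + ω + ω² = 0`) — the exact moduli `1, 0, 1/3, 2/3` of the
  centre-character coefficients of BLOCK-Φ;
* `norm_sum_mul_stdAddChar_le_of_junta` — **off-junta decay**: if `c(F)` depends only on `F|_J` then
  `‖Σ_{F ∈ {0,1}^q} c(F) ω^{⟨γ,F⟩}‖ ≤ 2^{−#{j ∉ J : γ_j ≠ 0}} Σ_F ‖c(F)‖` (fibre sum `TwoModuli.sum_eq_sum_sum_glue` and the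
  separation of variables `TwoModuli.norm_sum_stdAddChar_subsetSum_le`, [ChattopadhyayWigderson2009] Lemma 5, `cos(π/3) = 1/2`).

WHAT THIS IS NOT: no cell statement is proved here; consumed by `AffBells21BlockPhi.lean`.
-/

namespace Summit.QuantumAdvantage.AdviceFreeQNC0

open Finset
open Literature.Computability.MetaComplexity

namespace AffBells21

/-! ## Characters of `𝔽₃` and signed three-term sums -/

/-- `‖ω^x‖ = 1`. -/
theorem norm_stdAddChar_three (x : ZMod 3) : ‖(ZMod.stdAddChar x : ℂ)‖ = 1 := by
  rw [ZMod.stdAddChar_apply]; exact Circle.norm_coe _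

/-- Orthogonality on `𝔽₃`: `Σ_a ω^{s a} = 3·[s = 0]`. -/
theorem sum_stdAddChar_three (s : ZMod 3) :
    ∑ a : ZMod 3, (ZMod.stdAddChar (s * a) : ℂ) = if s = 0 then 3 else 0 := by
  have h := _root_.Literature.Analysis.Fourier.sum_stdAddChar_mul (N := 3) s
  simpa using h

/-- `ω^{Σ_i f i} = Π_i ω^{f i}`. -/
theorem stdAddChar_sum_eq_prod {ι : Type*} (s : Finset ι) (f : ι → ZMod 3) :
    (ZMod.stdAddChar (∑ i ∈ s, f i) : ℂ) = ∏ i ∈ s, (ZMod.stdAddChar (f i) : ℂ) := by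
  classical
  induction s using Finset.induction_on with
  | empty => simp
  | insert j s hj ih => rw [sum_insert hj, prod_insert hj, AddChar.map_add_eq_mul, ih]

/-- The three elements of `𝔽₃`. -/
theorem zmod3_cases (a : ZMod 3) : a = 0 ∨ a = 1 ∨ a = 2 := by
  revert a; decide

/-- Odd one out: three bits that are not all equal have exactly one dissenter `b`. -/
theorem exists_odd_one_out (nn : ZMod 3 → ℕ) (h2 : ∀ a, nn a < 2) (hne : ¬ (nn 0 = nn 1 ∧ nn 1 = nn 2)) :
    ∃ b : ZMod 3, ∀ a, a ≠ b → nn a + nn b = 1 := by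
  have h0 := h2 0
  have h1 := h2 1
  have h22 := h2 2
  by_cases e01 : nn 0 = nn 1
  · refine ⟨2, fun a ha => ?_⟩
    rcases zmod3_cases a with rfl | rfl | rfl
    · omega
    · omega
    · exact absurd rfl ha
  · by_cases e12 : nn 1 = nn 2
    · refine ⟨0, fun a ha => ?_⟩
      rcases zmod3_cases a with rfl | rfl | rfl
      · exact absurd rfl ha
      · omega
      · omega
    · refine ⟨1, fun a ha => ?_⟩
      rcases zmod3_cases a with rfl | rfl | rfl
      · omega
      · exact absurd rfl ha
      · omega

/-- Agreeing signs: `Σ_a (−1)^{n_a} ω^{s a} = (−1)^{n_0} · 3·[s = 0]` when the three parities agree. -/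
theorem signedCharSum_three_degen (nn : ZMod 3 → ℕ) (hdeg : nn 0 % 2 = nn 1 % 2 ∧ nn 1 % 2 = nn 2 % 2) (s : ZMod 3) :
    ∑ a : ZMod 3, (-1 : ℂ) ^ nn a * (ZMod.stdAddChar (s * a) : ℂ)
      = (-1 : ℂ) ^ nn 0 * (if s = 0 then 3 else 0) := by
  have hc : ∀ a : ZMod 3, (-1 : ℂ) ^ nn a = (-1 : ℂ) ^ nn 0 := by
    intro a
    rw [neg_one_pow_eq_pow_mod_two, neg_one_pow_eq_pow_mod_two (n := nn 0)]
    rcases zmod3_cases a with rfl | rfl | rfl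
    · rfl
    · rw [hdeg.1]
    · rw [hdeg.1, hdeg.2]
  simp_rw [hc]
  rw [← mul_sum, sum_stdAddChar_three]

/-- Disagreeing signs: `‖Σ_a (−1)^{n_a} ω^{s a}‖ = 1` for `s = 0` and `= 2` for `s ≠ 0` when the parities do not all
agree (the two equal signs cancel against the dissenter through `1 + ω + ω² = 0`). -/
theorem norm_signedCharSum_three (nn : ZMod 3 → ℕ) (hne : ¬ (nn 0 % 2 = nn 1 % 2 ∧ nn 1 % 2 = nn 2 % 2)) (s : ZMod 3) :
    ‖∑ a : ZMod 3, (-1 : ℂ) ^ nn a * (ZMod.stdAddChar (s * a) : ℂ)‖ = if s = 0 then 1 else 2 := by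
  obtain ⟨b, hb⟩ := exists_odd_one_out (fun a => nn a % 2) (fun a => Nat.mod_lt _ two_pos) hne
  have hopp : ∀ a, a ≠ b → (-1 : ℂ) ^ nn a = -(-1 : ℂ) ^ nn b := by
    intro a ha
    have h : nn a % 2 + nn b % 2 = 1 := hb a ha
    rw [neg_one_pow_eq_pow_mod_two, neg_one_pow_eq_pow_mod_two (n := nn b)]
    rcases Nat.mod_two_eq_zero_or_one (nn a) with h0 | h0 <;>
      rcases Nat.mod_two_eq_zero_or_one (nn b) with h1 | h1
    · omega
    · rw [h0, h1]; norm_num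
    · rw [h0, h1]; norm_num
    · omega
  have hsplit : ∑ a : ZMod 3, (-1 : ℂ) ^ nn a * (ZMod.stdAddChar (s * a) : ℂ)
      = (∑ a : ZMod 3, ((-1 : ℂ) ^ nn a + (-1 : ℂ) ^ nn b) * (ZMod.stdAddChar (s * a) : ℂ))
        - (-1 : ℂ) ^ nn b * ∑ a : ZMod 3, (ZMod.stdAddChar (s * a) : ℂ) := by
    rw [mul_sum, ← sum_sub_distrib]
    exact sum_congr rfl fun a _ => by ring
  have hsingle : ∑ a : ZMod 3, ((-1 : ℂ) ^ nn a + (-1 : ℂ) ^ nn b) * (ZMod.stdAddChar (s * a) : ℂ)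
      = 2 * (-1 : ℂ) ^ nn b * ZMod.stdAddChar (s * b) := by
    rw [Finset.sum_eq_single b]
    · ring
    · intro a _ ha
      rw [hopp a ha]
      ring
    · intro h
      exact absurd (mem_univ b) h
  have hnb : ‖(-1 : ℂ) ^ nn b‖ = 1 := by
    rw [norm_pow, norm_neg, norm_one, one_pow]
  rw [hsplit, hsingle, sum_stdAddChar_three]
  split_ifs with hs
  · subst hs
    rw [zero_mul, AddChar.map_zero_eq_one, mul_one,
      show (2 : ℂ) * (-1 : ℂ) ^ nn b - (-1 : ℂ) ^ nn b * 3 = -((-1 : ℂ) ^ nn b) by ring, norm_neg, hnb]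
  · rw [mul_zero, sub_zero, norm_mul, norm_mul, norm_stdAddChar_three, hnb]
    norm_num

/-! ## Off-junta decay -/

variable {q : ℕ}

/-- **Off-junta decay** (separation of variables, [ChattopadhyayWigderson2009] Lemma 5 with `cos(π/3) = 1/2`):
if `c(F)` depends only on the coins in `J`, then
`‖Σ_F c(F) ω^{⟨γ, F⟩}‖ ≤ 2^{−#{j ∉ J : γ_j ≠ 0}} · Σ_F ‖c(F)‖`. -/
theorem norm_sum_mul_stdAddChar_le_of_junta (J : Finset (Fin q)) (c : (Fin q → Bool) → ℂ)
    (hc : ∀ F F' : Fin q → Bool, (∀ j ∈ J, F j = F' j) → c F = c F') (γ : Fin q → ZMod 3) :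
    ‖∑ F : Fin q → Bool, c F * (ZMod.stdAddChar (∑ j : Fin q, if F j then γ j else 0) : ℂ)‖
      ≤ (2 : ℝ)⁻¹ ^ (univ.filter fun j : Fin q => j ∉ J ∧ γ j ≠ 0).card * ∑ F : Fin q → Bool, ‖c F‖ := by
  set v₀ : {i // i ∉ J} → Bool := fun _ => false with hv₀
  -- the linear form splits along `J`
  have hlin : ∀ (w : {i // i ∈ J} → Bool) (v : {i // i ∉ J} → Bool),
      (∑ j : Fin q, if TwoModuli.glue J w v j then γ j else 0)
        = (∑ k : {i // i ∈ J}, if w k then γ k else 0) + (∑ k : {i // i ∉ J}, if v k then γ k else 0) := by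
    intro w v
    have e1 : (∑ k : {i // i ∈ J}, if w k then γ k else 0)
        = ∑ k : {i // i ∈ J}, if TwoModuli.glue J w v k then γ k else 0 :=
      sum_congr rfl fun k _ => by rw [TwoModuli.glue_apply_mem w v k.2]
    have e2 : (∑ k : {i // i ∉ J}, if v k then γ k else 0)
        = ∑ k : {i // i ∉ J}, if TwoModuli.glue J w v k then γ k else 0 :=
      sum_congr rfl fun k _ => by rw [TwoModuli.glue_apply_not_mem w v k.2]
    rw [e1, e2, ← Finset.sum_subtype J (fun _ => Iff.rfl) (f := fun j => if TwoModuli.glue J w v j then γ j else 0),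
      ← Finset.sum_subtype (p := fun i => i ∉ J) Jᶜ (fun _ => Finset.mem_compl)
        (f := fun j => if TwoModuli.glue J w v j then γ j else 0),
      Finset.sum_add_sum_compl]
  -- `c` on glued vectors only depends on the `J`-part
  have hcw : ∀ (w : {i // i ∈ J} → Bool) (v : {i // i ∉ J} → Bool),
      c (TwoModuli.glue J w v) = c (TwoModuli.glue J w v₀) := fun w v =>
    hc _ _ fun j hj => by rw [TwoModuli.glue_apply_mem w v hj, TwoModuli.glue_apply_mem w v₀ hj]
  set T : ℂ := ∑ w : {i // i ∈ J} → Bool,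
    c (TwoModuli.glue J w v₀) * (ZMod.stdAddChar (∑ k : {i // i ∈ J}, if w k then γ k else 0) : ℂ) with hT
  have hfactor : ∑ F : Fin q → Bool, c F * (ZMod.stdAddChar (∑ j : Fin q, if F j then γ j else 0) : ℂ)
      = T * ∑ v : {i // i ∉ J} → Bool, (ZMod.stdAddChar (∑ k : {i // i ∉ J}, if v k then γ k else 0) : ℂ) := by
    rw [TwoModuli.sum_eq_sum_sum_glue J, mul_sum]
    refine sum_congr rfl fun v _ => ?_
    rw [hT, sum_mul]
    refine sum_congr rfl fun w _ => ?_
    rw [hlin w v, AddChar.map_add_eq_mul, hcw w v]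
    ring
  have hnormT : ‖T‖ ≤ ∑ w : {i // i ∈ J} → Bool, ‖c (TwoModuli.glue J w v₀)‖ := by
    refine (norm_sum_le _ _).trans (le_of_eq (sum_congr rfl fun w _ => ?_))
    rw [norm_mul, norm_stdAddChar_three, mul_one]
  have hchar := TwoModuli.norm_sum_stdAddChar_subsetSum_le (N := 3) (fun k : {i // i ∉ J} => γ k)
  have hcos : Real.cos (Real.pi / ((3 : ℕ) : ℝ)) = (2 : ℝ)⁻¹ := by
    rw [Nat.cast_ofNat, Real.cos_pi_div_three]
    norm_num
  have hcard : (univ.filter fun k : {i // i ∉ J} => γ k ≠ 0).card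
      = (univ.filter fun j : Fin q => j ∉ J ∧ γ j ≠ 0).card := by
    rw [← Fintype.card_subtype, ← Fintype.card_subtype]
    exact Fintype.card_congr (Equiv.subtypeSubtypeEquivSubtypeInter (fun j : Fin q => j ∉ J) (fun j => γ j ≠ 0))
  rw [hcos, hcard] at hchar
  have hsumc : ∑ F : Fin q → Bool, ‖c F‖
      = (2 : ℝ) ^ Fintype.card {i // i ∉ J} * ∑ w : {i // i ∈ J} → Bool, ‖c (TwoModuli.glue J w v₀)‖ := by
    rw [TwoModuli.sum_eq_sum_sum_glue J (fun F => ‖c F‖)]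
    rw [sum_congr rfl fun v _ => sum_congr rfl fun w _ => by rw [hcw w v], sum_const, card_univ,
      Fintype.card_fun, Fintype.card_bool, nsmul_eq_mul]
    push_cast
    ring
  rw [hfactor, norm_mul, hsumc]
  calc ‖T‖ * ‖∑ v : {i // i ∉ J} → Bool, (ZMod.stdAddChar (∑ k : {i // i ∉ J}, if v k then γ k else 0) : ℂ)‖
      ≤ (∑ w : {i // i ∈ J} → Bool, ‖c (TwoModuli.glue J w v₀)‖)
        * (2 ^ Fintype.card {i // i ∉ J}
            * (2 : ℝ)⁻¹ ^ (univ.filter fun j : Fin q => j ∉ J ∧ γ j ≠ 0).card) :=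
        mul_le_mul hnormT hchar (norm_nonneg _) (sum_nonneg fun _ _ => norm_nonneg _)
    _ = _ := by ring

end AffBells21

end Summit.QuantumAdvantage.AdviceFreeQNC0
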